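/-
Copyright (c) 2026 the pub-hodgecm-mathlib formalisation cell (harness21).  Prover seat hodgecm-mathlib-K2E1-p08 (g3), Track B ∕ K2-LIT
(build stream 29), h413 = `stmt-HodgeConjecture-24833`, line `K2_E1_TraceFormulaBeta`, row 10∕13 (DEAL F ∕ G2: `ε` on `[G̃]` and `R(ε)` on `L²([G̃])`);
dealer K2E1-plan (g2) RULINGS «G1 GO then G2 GO» 2026-09-04T01:27:06Z, «G1c∕G2 continue» 02:02:50Z.  2026-09-04.
-/
import Summits.HodgeConjecture.HodgeConjecture.Theorems.K2E1TwistEpsilonInvolution   -- ★ p856522 (K2E1-p08 g3): `twistAdelic_map_algebraMap_mem_range`, `twistAdelic_twistAdelic`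
import Literature.NumberTheory.Automorphic.AutomorphicGaloisConj                    -- ★ the `σ`-template: `galQuot`∕`galL2`∕`galConj`, `GLn.smul_posRealScalar`, `IsConjEquivariant`, `mapConj`
import Literature.NumberTheory.Automorphic.JPSSGlobalFunctionalEquation             -- ★ the `ᵗg⁻¹`-template: `GLn.transposeInv`, `glTransposeInvQuot`, `glTransposeInv_posRealScalar`
import Literature.NumberTheory.Automorphic.AdelicGroupDataUniquenessProofs          -- ★ `isAutomorphicMeasure_unique_smul_holds`
import HarnessLib

/-!
# h413 ∕ Track B «K2-LIT», line `K2_E1_TraceFormulaBeta`, row 10∕13 (G2) — DEFS leaf `K2E1TwistQuotientDefs`: the twist `ε` of `G̃ = Res_{E∕F} GL_n` ON THE AUTOMORPHIC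
# QUOTIENT `[G̃] = GL_n(𝔸_E) ⧸ A_G GL_n(E)` (`twistQuot`), the `ε`-invariance of automorphic measures, the UNITARY `R(ε) = twistL2` on `L²([G̃])` with
# `R(ε) R(g) = R(ε g) R(ε)`, `R(ε)² = 1`, and the `ε`-twist `ε(W)` of closed subrepresentations of `L²([G̃])` (`twistConj`)

Cell `pub/hodgecm-mathlib`, crux H413 = `stmt-HodgeConjecture-24833`, route of record `HCCMUnconditional`; chair K2-lead (g0), dealer K2E1-plan (g2) (DEAL F survey
`K2/K2E1-p08/g3/MEMO-DEALF-row10-survey.K2E1-p08-g3.md` item G2; RULING «G2 GO»: «`R(ε)` on `L²([GL₃])` via Mathlib `MeasurePreserving` → `Lp` isometry, `R(ε)R(φ̃)R(ε)⁻¹ =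
R(φ̃∘ε)`, `R(ε)² = 1`»; R6: new definitions in their own `…Defs` leaf, lane `--kind definition --supports stmt-HodgeConjecture-24833 --as helper`).  This is the operator
`ρ(ε)` ∕ `π̃(ε)` of the `ε`-twisted spectral side of Rogawski's comparison [Rogawski1990 §2.1 p. 12 «`(ρ(ε)φ)(g) = φ(ε⁻¹(g))`»; §13.5 p. 207 «a discrete automorphic representation
`π` … contributes `Tr(π(φ)π(ε))` to `θ_{G̃}`»; Arthur–Clozel Ch. 3 §1] on the WHOLE of `L²([G̃])` for the tree's datum ★ `AdelicGroupData.gl n E` (the GL currency of the Sigs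
sockets #12∕#8, `DiscreteAutomorphicRep (gl n K) μ`); the twisted traces on `ε`-stable discrete classes (G3) are downstream.  Built EXACTLY on the two tree templates
★ `AutomorphicGaloisConj` (`σ`: `galQuot`, `isAutomorphicMeasure_map_gal_smul`, `isGalInvariant_of_unique`, `galL2`, `galL2_rightRegular`, `galConj`) and
★ `JPSSGlobalFunctionalEquation` (`ι = ᵗ(·)⁻¹`: `GLn.transposeInv`, `glTransposeInvQuot`, `measurePreserving_glTransposeInvQuot`), with `σ`∕`ι` replaced by
`ε = twistAdelic F E n Φ c` (★ `K2E1GlobalTestFunctionsTwistedDefs`; `ε(g) = Φ⁻¹((σg)ᵀ)⁻¹Φ = Φ⁻¹ · ι(σ g) · Φ`):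
* §1 `twistGl` = `ε` re-exposed on the datum carrier `(gl n E).Adelic` (the structure projection is not unfolded by instance search, cf. ★ `GLn.transposeInv`);
  `twistGl_posRealScalar` (`ε(z(t)) = z(t⁻¹)`: ★ `GLn.smul_posRealScalar` + ★ `glTransposeInv_posRealScalar` + centrality of `A_G`), `twistGl_mem_quotientSubgroup` (rational part:
  ★ p856522 `twistAdelic_map_algebraMap_mem_range`), involutivity `twistGl_twistGl` for `c² = 1`, `Φ` `c`-hermitian (★ p856522 `twistAdelic_twistAdelic`), `twistMulEquiv`.
* §2 **`twistQuot`** `: [G̃] → [G̃]`, `[g] ↦ [ε g]` (Mathlib `Quotient.map'`), `twistQuot_smul` (`ε̄(g • x) = ε(g) • ε̄(x)`), involutivity, continuity, measurability,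
  `twistQuotMeasurableEquiv`.
* §3 `isAutomorphicMeasure_map_twistQuot` and **`measurePreserving_twistQuot`** (push-forward automorphic ⟹ `k • ν` by ★ `isAutomorphicMeasure_unique_smul_holds`, equal total
  masses ⟹ `k = 1`), `integral_comp_twistQuot`, `invQuot_comp_twistQuot` (the dictionary `φ̃ ↦ φ̃ ∘ ε` read on the group).
* §4 **`twistL2 ν : L²(ν) →ₗᵢ[ℂ] L²(ν)`**, `(R(ε)f)(x) = f(ε̄ x)` (Mathlib `Lp.compMeasurePreservingₗᵢ`; `ε̄⁻¹ = ε̄`), `twistL2_coeFn`, `twistL2_toLp`, `norm_twistL2`, **`twistL2_twistL2`**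
  (`R(ε)² = 1`), `twistL2Equiv`, **`twistL2_rightRegular`** (`R(ε) R(g) = R(ε g) R(ε)`), `isConjEquivariant_twistL2Equiv`.
* §5 **`twistConj W = R(ε)(W)`** for a closed subrepresentation `W ≤ L²(ν)` of the regular representation (★ `ClosedSubrep.mapConj`; on `R(ε)W` the element `g` acts as `ε g` on
  `W`, i.e. `R(ε)W ≅ W ∘ ε = W^ε`), `mem_twistConj_iff`, `twistConj_twistConj`, `isTopIrreducible_twistConj_iff`, and `ε`-stability `R(ε)W = W` («`π̃` is `ε`-invariant, `π̃ ∘ ε ≅ π̃`», realised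
  inside `L²`): `twistL2_mem_of_twistConj_eq`, `twistConj_eq_iff_forall_mem`.

HONEST LABEL.  Definitions leaf (`twistGl`, `twistMulEquiv`, `twistQuot`, `twistQuotMeasurableEquiv`, `twistL2`, `twistL2Equiv`, `twistConj` with their API; no `Prop`-valued
definition, no structure); closes no socket by itself; HC_CM is proved only modulo the 7 printed citations (2 remaining named inputs: hLiu418 = `stmt-HodgeConjecture-24832`, h413 =
`stmt-HodgeConjecture-24833`) until rung 0 closes.  NOT here: `R(ε)R(φ̃)R(ε)⁻¹ = R(φ̃ ∘ ε)` for the INTEGRATED operators (needs `ε_*(dg) = dg` on the group `GL_n(𝔸_E)`) and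
the twisted traces `Tr(π̃(φ̃)π̃(ε))` on `ε`-stable discrete classes (G3).

## References
* [Rogawski1990] J. D. Rogawski, *Automorphic Representations of Unitary Groups in Three Variables* (1990), §2.1 p. 12, §3.10 p. 33, §4.7 p. 47, §13.5 p. 207.
* [ArthurClozel1989] J. Arthur, L. Clozel, *Simple algebras, base change, and the advanced theory of the trace formula* (1989), Ch. 1 §2.1 (`Π^σ`), Ch. 3 §1.
* [Borel1963] A. Borel, *Some finiteness properties of adele groups over number fields*, Publ. Math. IHÉS 16 (1963), §5 (uniqueness of the invariant measure).
-/

set_option autoImplicit false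
-- the mandated namespace repeats `HodgeConjecture.HodgeConjecture`, as in every `Theorems/*.lean` of this sub-problem
set_option linter.dupNamespace false

noncomputable section

open NumberField IsDedekindDomain MeasureTheory Measure Set Filter Topology
open scoped MatrixGroups Matrix NNReal ENNReal

namespace Summit.HodgeConjecture.HodgeConjecture.Cruxes.H413.K2E1TwistQuotientDefs

open Literature.NumberTheory.Automorphic Literature.NumberTheory.Automorphic.UnitaryGroup AdelicGroupData
open Literature.NumberTheory.GaloisRepresentations (glTransposeInv)
open Summit.HodgeConjecture.HodgeConjecture.Cruxes.H413.K2E1GlobalTestFunctionsTwisted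
open Summit.HodgeConjecture.HodgeConjecture.Cruxes.H413.K2E1TwistEpsilonInvolution

variable (F : Type) {E : Type} [Field F] [Field E] [NumberField E] [Algebra F E] {n : ℕ} (Φ : GL (Fin n) E) (c : E ≃ₐ[F] E)

/-! ## §1 `ε` on the datum carrier `(gl n E).Adelic`; `ε` preserves `A_G · GL_n(E)` -/

/-- **`ε` as an endomorphism of the carrier `(gl n E).Adelic`** of the adelic datum: the continuous homomorphism ★ `twistAdelic F E n Φ c` (`ε(g) = Φ⁻¹((σg)ᵀ)⁻¹Φ`) re-exposed through
the structure projection `AdelicGroupData.Adelic` (which instance search does not unfold — exactly as ★ `GLn.transposeInv` does for `ᵗ(·)⁻¹`), so that `ε g • x` and `ε` of products in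
`A_G GL_n(E)` elaborate on the datum's own group structure. [cite: Rogawski1990, §4.7 p. 47; §3.10 p. 33] -/
def twistGl : (gl n E).Adelic →* (gl n E).Adelic where
  toFun g := twistAdelic F E n Φ c g
  map_one' := map_one (twistAdelic F E n Φ c)
  map_mul' g h := map_mul (twistAdelic F E n Φ c) g h

/-- `twistGl F Φ c g = ε g` (definitional). [folklore] -/
@[simp] theorem twistGl_apply (g : (gl n E).Adelic) : twistGl F Φ c g = twistAdelic F E n Φ c g := rfl

/-- **`ε ∘ ε = id`** for `c² = 1` and `Φ` `c`-hermitian (★ p856522 `twistAdelic_twistAdelic`). [cite: Rogawski1990, §3.10 p. 33] -/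
theorem twistGl_twistGl (hc : c * c = 1) (hΦ : ((Φ : GL (Fin n) E) : Matrix (Fin n) (Fin n) E)ᵀ.map c = (Φ : Matrix (Fin n) (Fin n) E)) (g : (gl n E).Adelic) :
    twistGl F Φ c (twistGl F Φ c g) = g :=
  twistAdelic_twistAdelic F E n Φ c hc hΦ g

/-- **`ε` as a group AUTOMORPHISM of `GL_n(𝔸_E)`** (its own inverse), the `θ` of ★ `ClosedSubrep.IsConjEquivariant` below. [cite: Rogawski1990, §3.10 p. 33] -/
def twistMulEquiv (hc : c * c = 1) (hΦ : ((Φ : GL (Fin n) E) : Matrix (Fin n) (Fin n) E)ᵀ.map c = (Φ : Matrix (Fin n) (Fin n) E)) : (gl n E).Adelic ≃* (gl n E).Adelic :=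
  (twistGl F Φ c).toMulEquiv (twistGl F Φ c) (MonoidHom.ext (twistGl_twistGl F Φ c hc hΦ)) (MonoidHom.ext (twistGl_twistGl F Φ c hc hΦ))

/-- `twistMulEquiv … g = ε g` (definitional). [folklore] -/
@[simp] theorem twistMulEquiv_apply (hc : c * c = 1) (hΦ : ((Φ : GL (Fin n) E) : Matrix (Fin n) (Fin n) E)ᵀ.map c = (Φ : Matrix (Fin n) (Fin n) E)) (g : (gl n E).Adelic) :
    twistMulEquiv F Φ c hc hΦ g = twistGl F Φ c g := rfl

/-- **`ε(z(t)) = z(t⁻¹)` on the split centre `A_G`**: `σ` fixes the positive real scalars (★ `GLn.smul_posRealScalar`), `ᵗ(z(t))⁻¹ = z(t⁻¹)` (★ `glTransposeInv_posRealScalar`), and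
`A_G` is central. [cite: Borel1963, §5] [cite: Rogawski1990, §3.10 p. 33] -/
theorem twistGl_posRealScalar (t : ℝ≥0ˣ) : twistGl F Φ c (posRealScalar n E t) = posRealScalar n E t⁻¹ := by
  have h1 : Matrix.GeneralLinearGroup.map (conjAdele F E c) (posRealScalar n E t) = posRealScalar n E t := GLn.smul_posRealScalar F c t
  have h3 : (formAdelic E n Φ)⁻¹ * posRealScalar n E t⁻¹ = posRealScalar n E t⁻¹ * (formAdelic E n Φ)⁻¹ :=
    Subgroup.mem_center_iff.mp (posRealScalar_mem_center n E t⁻¹) (formAdelic E n Φ)⁻¹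
  rw [twistGl_apply, twistAdelic_apply, h1, glTransposeInv_posRealScalar, h3, mul_assoc, inv_inv, inv_mul_cancel, mul_one]

/-- **`ε` preserves `A_G · GL_n(E)`** (split centre: `twistGl_posRealScalar`; rational part: ★ p856522 `twistAdelic_map_algebraMap_mem_range`; assembled as in ★
`glTransposeInv_mem_quotientSubgroup`). [cite: ArthurClozel1989, Ch. 3 §1] [cite: Borel1963, §5] -/
theorem twistGl_mem_quotientSubgroup {x : (gl n E).Adelic} (hx : x ∈ (gl n E).quotientSubgroup) : twistGl F Φ c x ∈ (gl n E).quotientSubgroup := by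
  have hmap : ((gl n E).quotientSubgroup).map (twistGl F Φ c) ≤ (gl n E).quotientSubgroup := by
    refine Subgroup.map_le_iff_le_comap.2 ?_
    change (gl n E).center' ⊔ (gl n E).arithmeticSubgroup ≤ _
    refine sup_le ?_ ?_
    · rintro _ ⟨t, rfl⟩
      exact Subgroup.mem_comap.2 ((gl n E).center'_le_quotientSubgroup ⟨t⁻¹, (twistGl_posRealScalar F Φ c t).symm⟩)
    · rintro _ ⟨γ, rfl⟩
      exact Subgroup.mem_comap.2 ((gl n E).arithmeticSubgroup_le_quotientSubgroup (twistAdelic_map_algebraMap_mem_range F E n Φ c γ))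
  exact hmap ⟨x, hx, rfl⟩

/-- **`ε x ∈ A_G GL_n(E) ↔ x ∈ A_G GL_n(E)`** for `c² = 1` and `Φ` `c`-hermitian. [cite: ArthurClozel1989, Ch. 3 §1] -/
theorem twistGl_mem_quotientSubgroup_iff (hc : c * c = 1) (hΦ : ((Φ : GL (Fin n) E) : Matrix (Fin n) (Fin n) E)ᵀ.map c = (Φ : Matrix (Fin n) (Fin n) E))
    (x : (gl n E).Adelic) : twistGl F Φ c x ∈ (gl n E).quotientSubgroup ↔ x ∈ (gl n E).quotientSubgroup :=
  ⟨fun h => by simpa only [twistGl_twistGl F Φ c hc hΦ] using twistGl_mem_quotientSubgroup F Φ c h, twistGl_mem_quotientSubgroup F Φ c⟩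

/-- `ε` is continuous on `(gl n E).Adelic` (★ `continuous_twistAdelic`). [folklore] -/
theorem continuous_twistGl : Continuous (twistGl F Φ c) :=
  continuous_twistAdelic F E n Φ c

/-- `ε` respects the left cosets of `A_G GL_n(E)`. [cite: ArthurClozel1989, Ch. 3 §1] -/
theorem leftRel_twistGl (a b : (gl n E).Adelic) (h : QuotientGroup.leftRel (gl n E).quotientSubgroup a b) :
    QuotientGroup.leftRel (gl n E).quotientSubgroup (twistGl F Φ c a) (twistGl F Φ c b) := by
  rw [QuotientGroup.leftRel_apply] at h ⊢
  rw [← map_inv, ← map_mul]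
  exact twistGl_mem_quotientSubgroup F Φ c h

/-! ## §2 `ε` on the automorphic quotient -/

/-- **The twist `ε̄` of the automorphic quotient** `[G̃] = GL_n(𝔸_E) ⧸ A_G GL_n(E)`: `ε̄ [g] = [ε g]` (well defined by §1; the `ε`-twin of ★ `galQuot` and ★ `glTransposeInvQuot`).  In terms of
functions, `φ̃ ↦ φ̃ ∘ ε̄` is print's `ρ(ε)φ̃ = φ̃ ∘ ε⁻¹ = φ̃ ∘ ε`. [cite: Rogawski1990, §2.1 p. 12] [cite: ArthurClozel1989, Ch. 3 §1] -/
def twistQuot : (gl n E).automorphicQuotient → (gl n E).automorphicQuotient :=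
  Quotient.map' (twistGl F Φ c) (leftRel_twistGl F Φ c)

/-- `ε̄ [g] = [ε g]` (definitional). [folklore] -/
@[simp] theorem twistQuot_toAutomorphicQuotient (g : (gl n E).Adelic) :
    twistQuot F Φ c ((gl n E).toAutomorphicQuotient g) = (gl n E).toAutomorphicQuotient (twistGl F Φ c g) := rfl

/-- **`ε̄ ∘ ε̄ = id`** for `c² = 1` and `Φ` `c`-hermitian. [cite: Rogawski1990, §3.10 p. 33] -/
theorem twistQuot_twistQuot (hc : c * c = 1) (hΦ : ((Φ : GL (Fin n) E) : Matrix (Fin n) (Fin n) E)ᵀ.map c = (Φ : Matrix (Fin n) (Fin n) E))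
    (x : (gl n E).automorphicQuotient) : twistQuot F Φ c (twistQuot F Φ c x) = x := by
  induction x using Quotient.inductionOn' with
  | h g =>
    change (gl n E).toAutomorphicQuotient (twistGl F Φ c (twistGl F Φ c g)) = (gl n E).toAutomorphicQuotient g
    rw [twistGl_twistGl F Φ c hc hΦ]

/-- `ε̄` is an involution. [folklore] -/
theorem twistQuot_involutive (hc : c * c = 1) (hΦ : ((Φ : GL (Fin n) E) : Matrix (Fin n) (Fin n) E)ᵀ.map c = (Φ : Matrix (Fin n) (Fin n) E)) :
    Function.Involutive (twistQuot F Φ c) :=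
  twistQuot_twistQuot F Φ c hc hΦ

/-- **Twisted equivariance `ε̄ (g • x) = ε(g) • ε̄ x`** for the `GL_n(𝔸_E)`-action on `[G̃]`. [folklore] -/
theorem twistQuot_smul (g : (gl n E).Adelic) (x : (gl n E).automorphicQuotient) : twistQuot F Φ c (g • x) = twistGl F Φ c g • twistQuot F Φ c x := by
  induction x using Quotient.inductionOn' with
  | h y =>
    change twistQuot F Φ c (g • (gl n E).toAutomorphicQuotient y) = twistGl F Φ c g • twistQuot F Φ c ((gl n E).toAutomorphicQuotient y)
    rw [AdelicGroupData.smul_toAutomorphicQuotient, twistQuot_toAutomorphicQuotient, twistQuot_toAutomorphicQuotient, AdelicGroupData.smul_toAutomorphicQuotient, map_mul]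

/-- `ε̄ (ε(g) • x) = g • ε̄ x` (`c² = 1`, `Φ` `c`-hermitian). [folklore] -/
theorem twistQuot_twistGl_smul (hc : c * c = 1) (hΦ : ((Φ : GL (Fin n) E) : Matrix (Fin n) (Fin n) E)ᵀ.map c = (Φ : Matrix (Fin n) (Fin n) E))
    (g : (gl n E).Adelic) (x : (gl n E).automorphicQuotient) : twistQuot F Φ c (twistGl F Φ c g • x) = g • twistQuot F Φ c x := by
  rw [twistQuot_smul, twistGl_twistGl F Φ c hc hΦ]

/-- `ε̄` is continuous (★ `continuous_twistAdelic` descends along the open quotient map). [folklore] -/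
theorem continuous_twistQuot : Continuous (twistQuot F Φ c) :=
  (continuous_twistGl F Φ c).quotient_map' (leftRel_twistGl F Φ c)

/-- `ε̄` is measurable (Borel). [folklore] -/
theorem measurable_twistQuot : Measurable (twistQuot F Φ c) :=
  (continuous_twistQuot F Φ c).measurable

/-- `ε̄` as a measurable equivalence of `[G̃]` (its own inverse). [folklore] -/
def twistQuotMeasurableEquiv (hc : c * c = 1) (hΦ : ((Φ : GL (Fin n) E) : Matrix (Fin n) (Fin n) E)ᵀ.map c = (Φ : Matrix (Fin n) (Fin n) E)) :
    (gl n E).automorphicQuotient ≃ᵐ (gl n E).automorphicQuotient where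
  toFun := twistQuot F Φ c
  invFun := twistQuot F Φ c
  left_inv := twistQuot_twistQuot F Φ c hc hΦ
  right_inv := twistQuot_twistQuot F Φ c hc hΦ
  measurable_toFun := measurable_twistQuot F Φ c
  measurable_invFun := measurable_twistQuot F Φ c

/-- `ε̄` is a measurable embedding. [folklore] -/
theorem measurableEmbedding_twistQuot (hc : c * c = 1) (hΦ : ((Φ : GL (Fin n) E) : Matrix (Fin n) (Fin n) E)ᵀ.map c = (Φ : Matrix (Fin n) (Fin n) E)) :
    MeasurableEmbedding (twistQuot F Φ c) :=
  (twistQuotMeasurableEquiv F Φ c hc hΦ).measurableEmbedding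

/-! ## §3 Automorphic measures are `ε̄`-invariant -/

section Measure

variable (hc : c * c = 1) (hΦ : ((Φ : GL (Fin n) E) : Matrix (Fin n) (Fin n) E)ᵀ.map c = (Φ : Matrix (Fin n) (Fin n) E))
include hc hΦ

/-- **The push-forward of an automorphic measure under `ε̄` is an automorphic measure** (finite; positive on opens — `ε̄` is onto, being an involution —; inner regular; and
`GL_n(𝔸_E)`-invariant since `ε̄⁻¹(g • s) = ε(g) • ε̄⁻¹(s)`).  The `ε`-twin of ★ `isAutomorphicMeasure_map_gal_smul` ∕ ★ `isAutomorphicMeasure_map_glTransposeInvQuot`. [cite: Borel1963, §5] -/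
theorem isAutomorphicMeasure_map_twistQuot (ν : Measure (gl n E).automorphicQuotient) [(gl n E).IsAutomorphicMeasure ν] :
    (gl n E).IsAutomorphicMeasure (ν.map (twistQuot F Φ c)) where
  toIsFiniteMeasure := Measure.isFiniteMeasure_map ν _
  toIsOpenPosMeasure := (continuous_twistQuot F Φ c).isOpenPosMeasure_map (twistQuot_involutive F Φ c hc hΦ).surjective
  toInnerRegularCompactLTTop := Measure.InnerRegularCompactLTTop.map_of_continuous (continuous_twistQuot F Φ c)
  toSMulInvariantMeasure := ⟨fun g s hs => by
    rw [Measure.map_apply (measurable_twistQuot F Φ c) hs,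
      Measure.map_apply (measurable_twistQuot F Φ c) (measurableSet_preimage (measurable_const_smul g) hs)]
    have : twistQuot F Φ c ⁻¹' ((fun x => g • x) ⁻¹' s) = (fun x => twistGl F Φ c g • x) ⁻¹' (twistQuot F Φ c ⁻¹' s) := by
      ext x
      simp only [Set.mem_preimage, twistQuot_twistGl_smul F Φ c hc hΦ]
    rw [this, SMulInvariantMeasure.measure_preimage_smul _ (measurable_twistQuot F Φ c hs)]⟩

/-- **Automorphic measures are `ε̄`-INVARIANT**: `ε̄` is measure preserving for EVERY automorphic `ν` — `ε̄_* ν` is automorphic, hence `k • ν` by the uniqueness of automorphic measures up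
to a positive scalar (★ `isAutomorphicMeasure_unique_smul_holds`, Borel 1963 §5), and `ε̄_* ν([G̃]) = ν([G̃])` with `0 < ν([G̃]) < ∞` forces `k = 1` (the `ε`-twin of ★ `isGalInvariant_of_unique`
∕ ★ `measurePreserving_glTransposeInvQuot`).  This is the unitarity of print's `ρ(ε)`. [cite: Borel1963, §5] [cite: Rogawski1990, §2.1 p. 12] -/
theorem measurePreserving_twistQuot (ν : Measure (gl n E).automorphicQuotient) [(gl n E).IsAutomorphicMeasure ν] : MeasurePreserving (twistQuot F Φ c) ν ν := by
  haveI := isAutomorphicMeasure_map_twistQuot F Φ c hc hΦ ν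
  obtain ⟨k, -, hkν⟩ := isAutomorphicMeasure_unique_smul_holds n E (ν.map (twistQuot F Φ c)) ν
  refine ⟨measurable_twistQuot F Φ c, ?_⟩
  have huniv : (ν.map (twistQuot F Φ c)) Set.univ = ν Set.univ := by
    rw [Measure.map_apply (measurable_twistQuot F Φ c) MeasurableSet.univ, Set.preimage_univ]
  have hne : ν Set.univ ≠ 0 := IsOpen.measure_ne_zero ν isOpen_univ ⟨(gl n E).toAutomorphicQuotient 1, trivial⟩
  have hk1 : k = 1 := by
    rw [hkν, Measure.smul_apply, ENNReal.smul_def, smul_eq_mul] at huniv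
    have h : (k : ENNReal) = 1 := by
      rw [← ENNReal.mul_left_inj hne (measure_ne_top ν _), one_mul]; exact huniv
    exact_mod_cast h
  rw [hk1, one_smul] at hkν
  exact hkν

/-- `∫ f (ε̄ x) dν = ∫ f dν` for an automorphic `ν` and every `f` (no measurability needed: `ε̄` is a measurable equivalence). [cite: Borel1963, §5] -/
theorem integral_comp_twistQuot (ν : Measure (gl n E).automorphicQuotient) [(gl n E).IsAutomorphicMeasure ν] (f : (gl n E).automorphicQuotient → ℂ) :
    ∫ x, f (twistQuot F Φ c x) ∂ν = ∫ x, f x ∂ν :=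
  (measurePreserving_twistQuot F Φ c hc hΦ ν).integral_comp (measurableEmbedding_twistQuot F Φ c hc hΦ) f

end Measure

/-- **The dictionary under `ε̄`**: `invQuot (φ ∘ ε̄) g = invQuot φ (ε g)`, i.e. `(φ̃ ∘ ε̄)` read on the group `GL_n(𝔸_E)` is `g ↦ φ̃(ε g)` (★ `invQuot`, the tree's quotient-to-group
dictionary). [cite: Rogawski1990, §2.1 p. 12] -/
theorem invQuot_comp_twistQuot (φ : (gl n E).automorphicQuotient → ℂ) (g : (gl n E).Adelic) :
    invQuot (gl n E) (φ ∘ twistQuot F Φ c) g = invQuot (gl n E) φ (twistGl F Φ c g) := by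
  rw [invQuot_apply, invQuot_apply, Function.comp_apply, twistQuot_toAutomorphicQuotient, map_inv]

/-! ## §4 The unitary `R(ε)` on `L²([G̃])` -/

section L2

variable (ν : Measure (gl n E).automorphicQuotient) [(gl n E).IsAutomorphicMeasure ν]
  (hc : c * c = 1) (hΦ : ((Φ : GL (Fin n) E) : Matrix (Fin n) (Fin n) E)ᵀ.map c = (Φ : Matrix (Fin n) (Fin n) E))

/-- **`R(ε) : L²(ν) →ₗᵢ[ℂ] L²(ν)`, `(R(ε) f)(x) = f(ε̄ x)`** — print's `ρ(ε)` ∕ `π̃(ε)` on the whole of `L²([G̃])` (`ε̄⁻¹ = ε̄`; Mathlib `Lp.compMeasurePreservingₗᵢ` along the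
measure-preserving `ε̄`; the `ε`-twin of ★ `galL2`). [cite: Rogawski1990, §2.1 p. 12; §13.5 p. 207] -/
def twistL2 : (gl n E).L2 ν →ₗᵢ[ℂ] (gl n E).L2 ν :=
  Lp.compMeasurePreservingₗᵢ ℂ (twistQuot F Φ c) (measurePreserving_twistQuot F Φ c hc hΦ ν)

variable {ν}

/-- The a.e. formula `(R(ε) f)(x) = f(ε̄ x)`. [folklore] -/
theorem twistL2_coeFn (f : (gl n E).L2 ν) : (twistL2 F Φ c ν hc hΦ f : (gl n E).automorphicQuotient → ℂ) =ᵐ[ν] fun x => f (twistQuot F Φ c x) :=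
  Lp.coeFn_compMeasurePreserving f (measurePreserving_twistQuot F Φ c hc hΦ ν)

/-- `R(ε)` on the class of a function: `R(ε) [φ] = [φ ∘ ε̄]`. [folklore] -/
theorem twistL2_toLp {φ : (gl n E).automorphicQuotient → ℂ} (hφ : MemLp φ 2 ν) :
    twistL2 F Φ c ν hc hΦ (hφ.toLp φ) = (hφ.comp_measurePreserving (measurePreserving_twistQuot F Φ c hc hΦ ν)).toLp (fun x => φ (twistQuot F Φ c x)) :=
  Lp.toLp_compMeasurePreserving hφ (measurePreserving_twistQuot F Φ c hc hΦ ν)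

/-- `R(ε)` preserves the norm. [folklore] -/
theorem norm_twistL2 (f : (gl n E).L2 ν) : ‖twistL2 F Φ c ν hc hΦ f‖ = ‖f‖ :=
  (twistL2 F Φ c ν hc hΦ).norm_map f

/-- **`R(ε)² = 1`** (`ε̄ ∘ ε̄ = id`). [cite: Rogawski1990, §3.10 p. 33] -/
theorem twistL2_twistL2 (f : (gl n E).L2 ν) : twistL2 F Φ c ν hc hΦ (twistL2 F Φ c ν hc hΦ f) = f := by
  change Lp.compMeasurePreserving _ (measurePreserving_twistQuot F Φ c hc hΦ ν) (Lp.compMeasurePreserving _ (measurePreserving_twistQuot F Φ c hc hΦ ν) f) = f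
  rw [← Lp.compMeasurePreserving_comp_apply f (measurePreserving_twistQuot F Φ c hc hΦ ν) (measurePreserving_twistQuot F Φ c hc hΦ ν),
    Lp.compMeasurePreserving_congr_fun (twistQuot_involutive F Φ c hc hΦ).comp_self _ (MeasurePreserving.id ν) f, Lp.compMeasurePreserving_id_apply]

/-- **`R(ε)` as a linear isometric EQUIVALENCE of `L²(ν)`** (its own inverse). [cite: Rogawski1990, §2.1 p. 12] -/
def twistL2Equiv : (gl n E).L2 ν ≃ₗᵢ[ℂ] (gl n E).L2 ν where
  toLinearEquiv :=
    { (twistL2 F Φ c ν hc hΦ).toLinearMap with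
      invFun := twistL2 F Φ c ν hc hΦ
      left_inv := twistL2_twistL2 F Φ c hc hΦ
      right_inv := twistL2_twistL2 F Φ c hc hΦ }
  norm_map' := norm_twistL2 F Φ c hc hΦ

/-- `twistL2Equiv` is `twistL2` as a function (definitional). [folklore] -/
@[simp] theorem coe_twistL2Equiv : ⇑(twistL2Equiv F Φ c hc hΦ (ν := ν)) = twistL2 F Φ c ν hc hΦ := rfl

/-- The inverse of `twistL2Equiv` is `twistL2` itself. [folklore] -/
@[simp] theorem twistL2Equiv_symm_apply (f : (gl n E).L2 ν) : (twistL2Equiv F Φ c hc hΦ (ν := ν)).symm f = twistL2 F Φ c ν hc hΦ f := rfl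

/-- **THE INTERTWINING RELATION `R(ε) R(g) = R(ε g) R(ε)`** between the twist and the regular representation of `GL_n(𝔸_E)` on `L²([G̃])`: on `R(ε)W` the element `g` acts as `ε g` acts
on `W` (`R(ε)W ≅ W ∘ ε`); with the integrated operators downstream, `R(ε)R(φ̃)R(ε)⁻¹ = R(φ̃ ∘ ε)` — the conjugation behind `Tr(π̃(φ̃)π̃(ε))`.  Proof = ★ `galL2_rightRegular` with `σ, σ⁻¹ ↦ ε`.
[cite: Rogawski1990, §2.1 p. 12; §13.5 p. 207] [cite: ArthurClozel1989, Ch. 3 §1] -/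
theorem twistL2_rightRegular (g : (gl n E).Adelic) (f : (gl n E).L2 ν) :
    twistL2 F Φ c ν hc hΦ ((gl n E).rightRegular ν g f) = (gl n E).rightRegular ν (twistGl F Φ c g) (twistL2 F Φ c ν hc hΦ f) := by
  apply Lp.ext
  have hmp := measurePreserving_twistQuot F Φ c hc hΦ ν
  have h1 := twistL2_coeFn F Φ c hc hΦ ((gl n E).rightRegular ν g f)
  -- `(R(ε) R(g) f)(x) = (R(g) f)(ε̄ x) = f (g⁻¹ • ε̄ x)` a.e.
  have h0 : ((gl n E).rightRegular ν g f : (gl n E).automorphicQuotient → ℂ) =ᵐ[ν.map (twistQuot F Φ c)] fun y => f (g⁻¹ • y) := by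
    rw [hmp.map_eq]; exact (gl n E).rightRegular_apply_coeFn ν g f
  have h2 := ae_eq_comp hmp.measurable.aemeasurable h0
  -- `(R(ε g) R(ε) f)(x) = (R(ε) f)((ε g)⁻¹ • x) = f (ε̄ ((ε g)⁻¹ • x))` a.e.
  have h3 := (gl n E).rightRegular_apply_coeFn ν (twistGl F Φ c g) (twistL2 F Φ c ν hc hΦ f)
  have h0' : (twistL2 F Φ c ν hc hΦ f : (gl n E).automorphicQuotient → ℂ) =ᵐ[ν.map fun x : (gl n E).automorphicQuotient => (twistGl F Φ c g)⁻¹ • x]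
      fun y => f (twistQuot F Φ c y) := by
    rw [(measurePreserving_smul ((twistGl F Φ c g)⁻¹) ν).map_eq]; exact twistL2_coeFn F Φ c hc hΦ f
  have h4 := ae_eq_comp (measurable_const_smul ((twistGl F Φ c g)⁻¹)).aemeasurable h0'
  -- and `g⁻¹ • ε̄ x = ε̄ ((ε g)⁻¹ • x)` since `ε (ε g)⁻¹ = g⁻¹`
  have h5 : ((fun y => (f : (gl n E).automorphicQuotient → ℂ) (g⁻¹ • y)) ∘ twistQuot F Φ c) =
      ((fun y => (f : (gl n E).automorphicQuotient → ℂ) (twistQuot F Φ c y)) ∘ fun x : (gl n E).automorphicQuotient => (twistGl F Φ c g)⁻¹ • x) := by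
    funext x
    simp only [Function.comp_apply]
    rw [← map_inv, twistQuot_twistGl_smul F Φ c hc hΦ]
  exact h1.trans (h2.trans ((Filter.EventuallyEq.of_eq h5).trans (h3.trans h4).symm))

/-- `R(ε)` is `ε`-conjugate equivariant for the regular representation (★ `ClosedSubrep.IsConjEquivariant` with `θ = ε = twistMulEquiv`). [cite: ArthurClozel1989, Ch. 1 §2.1; Ch. 3 §1] -/
theorem isConjEquivariant_twistL2Equiv :
    ContRepresentation.ClosedSubrep.IsConjEquivariant ((gl n E).rightRegular ν) ((gl n E).rightRegular ν)
      (twistL2Equiv F Φ c hc hΦ (ν := ν) : (gl n E).L2 ν ≃L[ℂ] (gl n E).L2 ν) (twistMulEquiv F Φ c hc hΦ) :=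
  fun g f => twistL2_rightRegular F Φ c hc hΦ g f

/-! ## §5 The `ε`-twist `R(ε)W` of a closed subrepresentation of `L²([G̃])` -/

/-- **The `ε`-twist `R(ε)(W)` of a closed subrepresentation** `W ≤ L²(ν)` of the regular representation of `GL_n(𝔸_E)`: the image of `W` under the unitary involution `R(ε)`, again a
closed subrepresentation (★ `ClosedSubrep.mapConj`), on which `R(g)` acts as `R(ε g)` acts on `W` — as an abstract representation `R(ε)W ≅ W ∘ ε = W^ε` («`π̃^ε(g) = π̃(ε(g))`»).
The `ε`-twin of ★ `ClosedSubrep.galConj`. [cite: ArthurClozel1989, Ch. 1 §2.1 (`Π^σ`); Ch. 3 §1] [cite: Rogawski1990, §13.5 p. 207] -/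
def twistConj (W : ContRepresentation.ClosedSubrep ((gl n E).rightRegular ν)) : ContRepresentation.ClosedSubrep ((gl n E).rightRegular ν) :=
  W.mapConj (isConjEquivariant_twistL2Equiv F Φ c hc hΦ (ν := ν))

/-- Membership in `R(ε)W`: `f ∈ R(ε)W ↔ R(ε) f ∈ W` (`R(ε)⁻¹ = R(ε)`). [folklore] -/
theorem mem_twistConj_iff (W : ContRepresentation.ClosedSubrep ((gl n E).rightRegular ν)) {f : (gl n E).L2 ν} :
    f ∈ twistConj F Φ c hc hΦ W ↔ twistL2 F Φ c ν hc hΦ f ∈ W :=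
  W.mem_mapConj_iff _

/-- `R(ε) f ∈ R(ε)W ↔ f ∈ W`. [folklore] -/
theorem twistL2_mem_twistConj_iff (W : ContRepresentation.ClosedSubrep ((gl n E).rightRegular ν)) {f : (gl n E).L2 ν} :
    twistL2 F Φ c ν hc hΦ f ∈ twistConj F Φ c hc hΦ W ↔ f ∈ W :=
  W.apply_mem_mapConj_iff _

/-- **`R(ε)(R(ε)W) = W`.** [folklore] -/
@[simp] theorem twistConj_twistConj (W : ContRepresentation.ClosedSubrep ((gl n E).rightRegular ν)) :
    twistConj F Φ c hc hΦ (twistConj F Φ c hc hΦ W) = W := by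
  ext f
  rw [mem_twistConj_iff, mem_twistConj_iff, twistL2_twistL2]

/-- `W ↦ R(ε)W` is injective. [folklore] -/
theorem twistConj_inj {W W' : ContRepresentation.ClosedSubrep ((gl n E).rightRegular ν)} : twistConj F Φ c hc hΦ W = twistConj F Φ c hc hΦ W' ↔ W = W' :=
  ContRepresentation.ClosedSubrep.mapConj_inj _

/-- **`R(ε)W` is irreducible iff `W` is.** [folklore] -/
theorem isTopIrreducible_twistConj_iff (W : ContRepresentation.ClosedSubrep ((gl n E).rightRegular ν)) :
    (twistConj F Φ c hc hΦ W).toContRep.IsTopIrreducible ↔ W.toContRep.IsTopIrreducible :=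
  W.isTopIrreducible_mapConj_iff _

/-- **`ε`-STABILITY `R(ε)W = W`** — the realisation inside `L²([G̃])` of «`π̃` is `ε`-invariant, `π̃ ∘ ε ≅ π̃`», the condition under which a discrete `π̃` contributes `Tr(π̃(φ̃)π̃(ε))` to
the `ε`-twisted trace [Rogawski1990 §13.5 p. 207; Arthur–Clozel Ch. 1 §2.1 «`Π` is `σ`-stable if it is equivalent to `Π^σ`»] — implies that `R(ε)` maps `W` into itself (so restricts to a
unitary involution of `W`). [cite: Rogawski1990, §13.5 p. 207] [cite: ArthurClozel1989, Ch. 1 §2.1] -/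
theorem twistL2_mem_of_twistConj_eq {W : ContRepresentation.ClosedSubrep ((gl n E).rightRegular ν)} (hW : twistConj F Φ c hc hΦ W = W) {f : (gl n E).L2 ν} (hf : f ∈ W) :
    twistL2 F Φ c ν hc hΦ f ∈ W := by
  rw [← mem_twistConj_iff F Φ c hc hΦ W, hW]
  exact hf

/-- **`R(ε)W = W ↔ R(ε)` maps `W` into itself** (the converse inclusion is automatic since `R(ε)² = 1`). [cite: ArthurClozel1989, Ch. 1 §2.1] -/
theorem twistConj_eq_iff_forall_mem (W : ContRepresentation.ClosedSubrep ((gl n E).rightRegular ν)) :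
    twistConj F Φ c hc hΦ W = W ↔ ∀ f ∈ W, twistL2 F Φ c ν hc hΦ f ∈ W := by
  refine ⟨fun hW f hf => twistL2_mem_of_twistConj_eq F Φ c hc hΦ hW hf, fun h => ?_⟩
  ext f
  rw [mem_twistConj_iff]
  refine ⟨fun hf => ?_, fun hf => h f hf⟩
  simpa only [twistL2_twistL2] using h _ hf

end L2

end Summit.HodgeConjecture.HodgeConjecture.Cruxes.H413.K2E1TwistQuotientDefs

end
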